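import Literature.Analysis.Complex.WeightedArgumentPrinciple
import Literature.NumberTheory.LFunctions.ZetaArgVariation
import HarnessLib

/-!
# Littlewood's lemma on a rectangle (Titchmarsh §9.9), in logarithmic-derivative form

Topic `Literature/NumberTheory/LFunctions` (it serves the zero-counting programmes for `ζ`:
Levinson's method, Titchmarsh §10.28 (10.28.11); Selberg's theorem, §10.22; Carlson's density
theorem, §9.15). Proofs only: no definitions, no named facts.

**Littlewood's lemma** (J. E. Littlewood 1924; Titchmarsh, *The Theory of the Riemann
Zeta-Function*, §9.9, eq. (9.9.1)): for `f` analytic on the closed rectangle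
`R = [a, b] × [c, d]` and non-zero on `∂R`,

  `2π ∫_a^b ν(σ) dσ = ∫_c^d log|f(a+it)| dt − ∫_c^d log|f(b+it)| dt + ∫_a^b arg f(σ+id) dσ − ∫_a^b arg f(σ+ic) dσ`,

where `ν(σ)` is the number of zeros of `f` in `R` with real part `> σ` and `arg f` is continued
continuously along `∂R` from a fixed corner; and `∫_a^b ν(σ) dσ = Σ_ρ m(ρ) (Re ρ − a)`, the sum over
the zeros `ρ` of `f` in `R°` with multiplicities `m(ρ)`.

We prove it in a branch-free form in which every `arg` is replaced by an integral of the
logarithmic derivative (`d/dx arg f(x+iy) = Im (f'/f)(x+iy)`, `d/dy arg f(x+iy) = Re (f'/f)(x+iy)`):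

  `2π Σ_ρ m(ρ) (Re ρ − a) = ∫_c^d log‖f(a+it)‖ dt − ∫_c^d log‖f(b+it)‖ dt`
  `    + (b − a) ∫_c^d Re (f'/f)(b+it) dt + ∫_a^b (x − a) Im (f'/f)(x+ic) dx − ∫_a^b (x − a) Im (f'/f)(x+id) dx`

(`Literature.NumberTheory.LFunctions.littlewood_lemma`). Integrating `arg f(σ + iy) =
arg f(b + iy) − ∫_σ^b Im (f'/f)(x+iy) dx` over `σ ∈ [a, b]` and `arg f(b+id) − arg f(b+ic) =
∫_c^d Re (f'/f)(b+it) dt` shows that this is (9.9.1) with `arg f` continued from the corner `b + ic`.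

Proof: the weighted argument principle with weight `g(z) = z − a`
(`Literature.Analysis.Complex.integral_boundary_rect_logDeriv_mul`:
`∮_{∂R} (f'/f)(z) (z − a) dz = 2πi Σ_ρ m(ρ)(ρ − a)`), imaginary parts, and one integration by parts
on each vertical edge (`∫ t · Im(f'/f)(x+it) dt`, using `d/dt log‖f(x+it)‖ = −Im (f'/f)(x+it)`,
`Literature.NumberTheory.LFunctions.hasDerivAt_log_norm_comp_vertical`); the corner terms
`c log‖f(a+ic)‖, …` cancel.

Also recorded: the form in which the lemma is *used* in Levinson's and Selberg's methods
(Titchmarsh §9.16, §10.28: "`N ≤ (log T₂ / a) ∫_u^2 ν(σ, T₁, T₂) dσ`"): the zeros with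
`Re ρ ≥ σ₀` each contribute at least `σ₀ − a` (and all terms are `≥ 0`), so
`2π (σ₀ − a) · #{ρ ∈ R° : f(ρ) = 0, Re ρ ≥ σ₀}` (with multiplicity) is at most the right-hand
side (`Literature.NumberTheory.LFunctions.littlewood_count_le`).

Finally, the two estimates that turn the right-hand side into the shape used there
(Titchmarsh §9.16: "`∫ log|f| ≤ ½(T₂ − T₁) log((T₂ − T₁)⁻¹ ∫ |f|²)`", and the horizontal edges
"`≪ log T` by the usual application of Jensen's formula"): the horizontal terms equal
`∫_a^b (∫_σ^b Im(f'/f)(x+iy) dx) dσ` (`integral_sub_mul_eq_integral_integral`), hence are at most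
`(b − a) · B` whenever `|Im ∫_σ^b (f'/f)(x+iy) dx| ≤ B` for all `σ ∈ [a, b]` — the quantity bounded by
Backlund's lemma (`Literature.Analysis.Complex.abs_im_integral_logDeriv_le_backlund`); and the
arithmetic–geometric mean inequality `∫_c^d log h ≤ (d − c) log((d − c)⁻¹ ∫_c^d h)` for positive
continuous `h` (`integral_log_le_mul_log_average`), applied to `h = ‖f(a+it)‖²`. Together:
`littlewood_count_le_of_meanSquare`.

## Main results

* `integral_mul_im_logDeriv_vertical` — `∫_c^d t Im(f'/f)(x+it) dt = −[t log‖f(x+it)‖]_c^d + ∫_c^d log‖f(x+it)‖ dt`.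
* `littlewood_lemma` — Littlewood's lemma (9.9.1), logarithmic-derivative form.
* `littlewood_count_le` — the zero count with `Re ρ ≥ σ₀` against the boundary integrals.
* `integral_sub_mul_eq_integral_integral`, `abs_integral_sub_mul_le`,
  `abs_integral_sub_mul_im_logDeriv_le` — the horizontal terms against a Backlund-type bound.
* `integral_log_le_mul_log_average` — `∫ log h ≤ (d − c) log(average of h)`.
* `littlewood_count_le_of_meanSquare` — `2π(σ₀ − a) N(σ₀) ≤ ½(d−c) log((d−c)⁻¹ ∫_c^d ‖f(a+it)‖²dt)
  − ∫_c^d log‖f(b+it)‖dt + (b−a) ∫_c^d Re(f'/f)(b+it)dt + (b−a)(B_c + B_d)`.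

## References

* [Titchmarsh1986] E. C. Titchmarsh, *The Theory of the Riemann Zeta-Function*, 2nd ed. revised
  by D. R. Heath-Brown, Oxford 1986, §9.9 (Littlewood's lemma, (9.9.1)), §9.16, §10.28.
* J. E. Littlewood, *On the zeros of the Riemann zeta-function*, Proc. Cambridge Philos. Soc. 22
  (1924), 295–318.
-/

noncomputable section

open Complex Set MeasureTheory intervalIntegral
open scoped Real Topology

namespace Literature.NumberTheory.LFunctions

open Literature.Analysis.Complex

variable {a b c d : ℝ}

/-! ## Calculus on the edges -/

/-- Imaginary part of `w · (u + iv)` for real `u, v`. [folklore] -/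
private lemma im_mul_ofReal_add_mul_I (w : ℂ) (u v : ℝ) :
    (w * (u + v * I)).im = u * w.im + v * w.re := by
  simp [mul_im]; ring

/-- Real part of `w · (u + iv)` for real `u, v`. [folklore] -/
private lemma re_mul_ofReal_add_mul_I (w : ℂ) (u v : ℝ) :
    (w * (u + v * I)).re = u * w.re - v * w.im := by
  simp [mul_re]; ring

/-- The logarithmic derivative `f'/f` is continuous along a horizontal segment on which `f` is
analytic and non-zero. [folklore] -/
theorem continuousOn_logDeriv_horizontal {f : ℂ → ℂ} {y : ℝ}
    (hf : ∀ x ∈ Icc a b, AnalyticAt ℂ f (x + y * I)) (h0 : ∀ x ∈ Icc a b, f (x + y * I) ≠ 0) :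
    ContinuousOn (fun x : ℝ ↦ deriv f (x + y * I) / f (x + y * I)) (Icc a b) := by
  intro x hx
  have hc : Continuous fun x : ℝ ↦ (x : ℂ) + y * I := by fun_prop
  exact (((hf x hx).deriv.continuousAt.comp (f := fun x : ℝ ↦ (x : ℂ) + y * I) hc.continuousAt).div
    ((hf x hx).continuousAt.comp (f := fun x : ℝ ↦ (x : ℂ) + y * I) hc.continuousAt)
    (h0 x hx)).continuousWithinAt

/-- The logarithmic derivative `f'/f` is continuous along a vertical segment on which `f` is
analytic and non-zero. [folklore] -/
theorem continuousOn_logDeriv_vertical {f : ℂ → ℂ} {x : ℝ}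
    (hf : ∀ y ∈ Icc c d, AnalyticAt ℂ f (x + y * I)) (h0 : ∀ y ∈ Icc c d, f (x + y * I) ≠ 0) :
    ContinuousOn (fun y : ℝ ↦ deriv f (x + y * I) / f (x + y * I)) (Icc c d) := by
  intro y hy
  have hc : Continuous fun y : ℝ ↦ (x : ℂ) + y * I := by fun_prop
  exact (((hf y hy).deriv.continuousAt.comp (f := fun y : ℝ ↦ (x : ℂ) + y * I) hc.continuousAt).div
    ((hf y hy).continuousAt.comp (f := fun y : ℝ ↦ (x : ℂ) + y * I) hc.continuousAt)
    (h0 y hy)).continuousWithinAt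

/-- `t ↦ log ‖f(x + it)‖` is continuous along a vertical segment on which `f` is analytic and
non-zero. [folklore] -/
theorem continuousOn_log_norm_vertical {f : ℂ → ℂ} {x : ℝ}
    (hf : ∀ y ∈ Icc c d, AnalyticAt ℂ f (x + y * I)) (h0 : ∀ y ∈ Icc c d, f (x + y * I) ≠ 0) :
    ContinuousOn (fun y : ℝ ↦ Real.log ‖f (x + y * I)‖) (Icc c d) := by
  intro y hy
  have hc : Continuous fun y : ℝ ↦ (x : ℂ) + y * I := by fun_prop
  have h1 : ContinuousAt (fun y : ℝ ↦ f (x + y * I)) y :=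
    (hf y hy).continuousAt.comp (f := fun y : ℝ ↦ (x : ℂ) + y * I) hc.continuousAt
  exact ((h1.norm).log (norm_ne_zero_iff.2 (h0 y hy))).continuousWithinAt

/-- **Integration by parts on a vertical edge.** If `f` is analytic and non-zero on
`{x} × [c, d]`, then
`∫_c^d t · Im (f'/f)(x+it) dt = −(d log‖f(x+id)‖ − c log‖f(x+ic)‖) + ∫_c^d log‖f(x+it)‖ dt`
(`d/dt log‖f(x+it)‖ = −Im (f'/f)(x+it)`). [folklore] -/
theorem integral_mul_im_logDeriv_vertical {f : ℂ → ℂ} {x : ℝ} (hcd : c ≤ d)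
    (hf : ∀ y ∈ Icc c d, AnalyticAt ℂ f (x + y * I)) (h0 : ∀ y ∈ Icc c d, f (x + y * I) ≠ 0) :
    ∫ y in c..d, y * (deriv f (x + y * I) / f (x + y * I)).im =
      -(d * Real.log ‖f (x + d * I)‖ - c * Real.log ‖f (x + c * I)‖) +
        ∫ y in c..d, Real.log ‖f (x + y * I)‖ := by
  have hu : ∀ y ∈ uIcc c d, HasDerivAt (fun y : ℝ ↦ y) 1 y := fun y _ ↦ hasDerivAt_id y
  have hv : ∀ y ∈ uIcc c d, HasDerivAt (fun y : ℝ ↦ Real.log ‖f (x + y * I)‖)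
      (-(deriv f (x + y * I) / f (x + y * I)).im) y := by
    intro y hy
    rw [uIcc_of_le hcd] at hy
    exact hasDerivAt_log_norm_comp_vertical (hf y hy) (h0 y hy)
  have hu' : IntervalIntegrable (fun _ : ℝ ↦ (1 : ℝ)) volume c d := intervalIntegrable_const
  have hv' : IntervalIntegrable (fun y : ℝ ↦ -(deriv f (x + y * I) / f (x + y * I)).im) volume c d :=
    ((continuous_im.comp_continuousOn (continuousOn_logDeriv_vertical hf h0)).neg).intervalIntegrable_of_Icc
      hcd
  have h := intervalIntegral.integral_mul_deriv_eq_deriv_mul hu hv hu' hv'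
  simp only [mul_neg, intervalIntegral.integral_neg, one_mul] at h
  linarith

/-! ## The imaginary parts of the four edge integrals of `(f'/f)(z) (z − a)` -/

/-- Horizontal edge at height `y`:
`Im ∫_a^b (f'/f)(x+iy) (x − a + iy) dx = ∫_a^b (x − a) Im(f'/f)(x+iy) dx + y (log‖f(b+iy)‖ − log‖f(a+iy)‖)`.
[folklore] -/
theorem im_integral_logDeriv_mul_horizontal {f : ℂ → ℂ} {y : ℝ} (hab : a ≤ b)
    (hf : ∀ x ∈ Icc a b, AnalyticAt ℂ f (x + y * I)) (h0 : ∀ x ∈ Icc a b, f (x + y * I) ≠ 0) :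
    (∫ x in a..b, deriv f (x + y * I) / f (x + y * I) * ((x : ℂ) + y * I - a)).im =
      (∫ x in a..b, (x - a) * (deriv f (x + y * I) / f (x + y * I)).im) +
        y * (Real.log ‖f (b + y * I)‖ - Real.log ‖f (a + y * I)‖) := by
  have hL := continuousOn_logDeriv_horizontal hf h0
  have hlin : Continuous fun x : ℝ ↦ (x : ℂ) + y * I - a := by fun_prop
  have hint : IntervalIntegrable
      (fun x : ℝ ↦ deriv f (x + y * I) / f (x + y * I) * ((x : ℂ) + y * I - a)) volume a b :=
    (hL.mul hlin.continuousOn).intervalIntegrable_of_Icc hab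
  have hcomm := Complex.imCLM.intervalIntegral_comp_comm hint
  simp only [Complex.imCLM_apply] at hcomm
  rw [← hcomm]
  have hpt : ∀ x : ℝ, (deriv f (x + y * I) / f (x + y * I) * ((x : ℂ) + y * I - a)).im =
      (x - a) * (deriv f (x + y * I) / f (x + y * I)).im +
        y * (deriv f (x + y * I) / f (x + y * I)).re := by
    intro x
    rw [show ((x : ℂ) + y * I - a) = ((x - a : ℝ) : ℂ) + (y : ℂ) * I by push_cast; ring,
      im_mul_ofReal_add_mul_I]
  simp_rw [hpt]
  have hi1 : IntervalIntegrable (fun x : ℝ ↦ (x - a) * (deriv f (x + y * I) / f (x + y * I)).im)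
      volume a b :=
    ((continuous_sub_right a).continuousOn.mul (continuous_im.comp_continuousOn hL)).intervalIntegrable_of_Icc hab
  have hi2 : IntervalIntegrable (fun x : ℝ ↦ y * (deriv f (x + y * I) / f (x + y * I)).re)
      volume a b :=
    (continuousOn_const.mul (continuous_re.comp_continuousOn hL)).intervalIntegrable_of_Icc hab
  rw [intervalIntegral.integral_add hi1 hi2, intervalIntegral.integral_const_mul,
    integral_re_logDeriv_horizontal hab hf h0]

/-- Right edge: `Im (i ∫_c^d (f'/f)(b+it) (b − a + it) dt)
= (b − a) ∫_c^d Re(f'/f)(b+it) dt + (d log‖f(b+id)‖ − c log‖f(b+ic)‖) − ∫_c^d log‖f(b+it)‖ dt`.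
[folklore] -/
theorem im_I_mul_integral_logDeriv_mul_right {f : ℂ → ℂ} (hcd : c ≤ d)
    (hf : ∀ y ∈ Icc c d, AnalyticAt ℂ f (b + y * I)) (h0 : ∀ y ∈ Icc c d, f (b + y * I) ≠ 0) :
    (I * ∫ y in c..d, deriv f (b + y * I) / f (b + y * I) * ((b : ℂ) + y * I - a)).im =
      (b - a) * (∫ y in c..d, (deriv f (b + y * I) / f (b + y * I)).re) +
        (d * Real.log ‖f (b + d * I)‖ - c * Real.log ‖f (b + c * I)‖) -
          ∫ y in c..d, Real.log ‖f (b + y * I)‖ := by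
  have hL := continuousOn_logDeriv_vertical hf h0
  have hlin : Continuous fun y : ℝ ↦ (b : ℂ) + y * I - a := by fun_prop
  have hint : IntervalIntegrable
      (fun y : ℝ ↦ deriv f (b + y * I) / f (b + y * I) * ((b : ℂ) + y * I - a)) volume c d :=
    (hL.mul hlin.continuousOn).intervalIntegrable_of_Icc hcd
  rw [I_mul_im]
  have hcomm := Complex.reCLM.intervalIntegral_comp_comm hint
  simp only [Complex.reCLM_apply] at hcomm
  rw [← hcomm]
  have hpt : ∀ y : ℝ, (deriv f (b + y * I) / f (b + y * I) * ((b : ℂ) + y * I - a)).re =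
      (b - a) * (deriv f (b + y * I) / f (b + y * I)).re -
        y * (deriv f (b + y * I) / f (b + y * I)).im := by
    intro y
    rw [show ((b : ℂ) + y * I - a) = ((b - a : ℝ) : ℂ) + (y : ℂ) * I by push_cast; ring,
      re_mul_ofReal_add_mul_I]
  simp_rw [hpt]
  have hi1 : IntervalIntegrable (fun y : ℝ ↦ (b - a) * (deriv f (b + y * I) / f (b + y * I)).re)
      volume c d :=
    (continuousOn_const.mul (continuous_re.comp_continuousOn hL)).intervalIntegrable_of_Icc hcd
  have hi2 : IntervalIntegrable (fun y : ℝ ↦ y * (deriv f (b + y * I) / f (b + y * I)).im)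
      volume c d :=
    (continuous_id.continuousOn.mul (continuous_im.comp_continuousOn hL)).intervalIntegrable_of_Icc hcd
  rw [intervalIntegral.integral_sub hi1 hi2, intervalIntegral.integral_const_mul,
    integral_mul_im_logDeriv_vertical hcd hf h0]
  ring

/-- Left edge: `Im (i ∫_c^d (f'/f)(a+it) (it) dt) = (d log‖f(a+id)‖ − c log‖f(a+ic)‖) − ∫_c^d log‖f(a+it)‖ dt`.
[folklore] -/
theorem im_I_mul_integral_logDeriv_mul_left {f : ℂ → ℂ} (hcd : c ≤ d)
    (hf : ∀ y ∈ Icc c d, AnalyticAt ℂ f (a + y * I)) (h0 : ∀ y ∈ Icc c d, f (a + y * I) ≠ 0) :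
    (I * ∫ y in c..d, deriv f (a + y * I) / f (a + y * I) * ((a : ℂ) + y * I - a)).im =
      (d * Real.log ‖f (a + d * I)‖ - c * Real.log ‖f (a + c * I)‖) -
        ∫ y in c..d, Real.log ‖f (a + y * I)‖ := by
  have hL := continuousOn_logDeriv_vertical hf h0
  have hlin : Continuous fun y : ℝ ↦ (a : ℂ) + y * I - a := by fun_prop
  have hint : IntervalIntegrable
      (fun y : ℝ ↦ deriv f (a + y * I) / f (a + y * I) * ((a : ℂ) + y * I - a)) volume c d :=
    (hL.mul hlin.continuousOn).intervalIntegrable_of_Icc hcd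
  rw [I_mul_im]
  have hcomm := Complex.reCLM.intervalIntegral_comp_comm hint
  simp only [Complex.reCLM_apply] at hcomm
  rw [← hcomm]
  have hpt : ∀ y : ℝ, (deriv f (a + y * I) / f (a + y * I) * ((a : ℂ) + y * I - a)).re =
      -(y * (deriv f (a + y * I) / f (a + y * I)).im) := by
    intro y
    rw [show ((a : ℂ) + y * I - a) = ((0 : ℝ) : ℂ) + (y : ℂ) * I by push_cast; ring,
      re_mul_ofReal_add_mul_I]
    ring
  simp_rw [hpt]
  rw [intervalIntegral.integral_neg, integral_mul_im_logDeriv_vertical hcd hf h0]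
  ring

/-! ## Littlewood's lemma -/

/-- **Littlewood's lemma** (Titchmarsh §9.9, (9.9.1)), logarithmic-derivative form. Let `f` be
analytic at every point of the closed rectangle `R = [a,b] × [c,d]` (`a < b`, `c < d`) and
non-zero on its four edges. Then, summing over the (finitely many) zeros `ρ` of `f` in `R°` with
multiplicities `m(ρ)`,
`2π Σ_ρ m(ρ)(Re ρ − a) = ∫_c^d log‖f(a+it)‖ dt − ∫_c^d log‖f(b+it)‖ dt + (b − a) ∫_c^d Re(f'/f)(b+it) dt`
`  + ∫_a^b (x − a) Im(f'/f)(x+ic) dx − ∫_a^b (x − a) Im(f'/f)(x+id) dx`.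
The last three terms are `∫_a^b arg f(σ+id) dσ − ∫_a^b arg f(σ+ic) dσ` of (9.9.1) with `arg f`
continued along `∂R` from the corner `b + ic`
(`arg f(σ+iy) = arg f(b+iy) − ∫_σ^b Im(f'/f)(x+iy) dx`, `arg f(b+id) − arg f(b+ic) = ∫_c^d Re(f'/f)(b+it) dt`),
and the left side is `2π ∫_a^b ν(σ) dσ`. [cite: Titchmarsh1986, §9.9 (9.9.1)] -/
theorem littlewood_lemma {f : ℂ → ℂ} (hab : a < b) (hcd : c < d)
    (hf : AnalyticOnNhd ℂ f (Icc a b ×ℂ Icc c d))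
    (h_bot : ∀ x ∈ Icc a b, f (x + c * I) ≠ 0) (h_top : ∀ x ∈ Icc a b, f (x + d * I) ≠ 0)
    (h_left : ∀ y ∈ Icc c d, f (a + y * I) ≠ 0) (h_right : ∀ y ∈ Icc c d, f (b + y * I) ≠ 0) :
    2 * π * ∑ᶠ ρ ∈ {ρ : ℂ | f ρ = 0 ∧ ρ ∈ Ioo a b ×ℂ Ioo c d},
        ((meromorphicOrderAt f ρ).untop₀ : ℝ) * (ρ.re - a) =
      (∫ y in c..d, Real.log ‖f (a + y * I)‖) - (∫ y in c..d, Real.log ‖f (b + y * I)‖) +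
        (b - a) * (∫ y in c..d, (deriv f (b + y * I) / f (b + y * I)).re) +
        (∫ x in a..b, (x - a) * (deriv f (x + c * I) / f (x + c * I)).im) -
        (∫ x in a..b, (x - a) * (deriv f (x + d * I) / f (x + d * I)).im) := by
  -- the weighted argument principle with weight `z − a`
  have hg : AnalyticOnNhd ℂ (fun z : ℂ ↦ z - a) (Icc a b ×ℂ Icc c d) := fun z _ ↦
    analyticAt_id.sub analyticAt_const
  have hAP := integral_boundary_rect_logDeriv_mul hab hcd hf hg h_bot h_top h_left h_right
  beta_reduce at hAP
  -- analyticity on the edges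
  have hf_bot : ∀ x ∈ Icc a b, AnalyticAt ℂ f (x + c * I) := fun x hx ↦
    hf _ ⟨by simpa using hx, by simpa using left_mem_Icc.2 hcd.le⟩
  have hf_top : ∀ x ∈ Icc a b, AnalyticAt ℂ f (x + d * I) := fun x hx ↦
    hf _ ⟨by simpa using hx, by simpa using right_mem_Icc.2 hcd.le⟩
  have hf_left : ∀ y ∈ Icc c d, AnalyticAt ℂ f (a + y * I) := fun y hy ↦
    hf _ ⟨by simpa using left_mem_Icc.2 hab.le, by simpa using hy⟩
  have hf_right : ∀ y ∈ Icc c d, AnalyticAt ℂ f (b + y * I) := fun y hy ↦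
    hf _ ⟨by simpa using right_mem_Icc.2 hab.le, by simpa using hy⟩
  -- imaginary parts of the four edge integrals
  have e_bot := im_integral_logDeriv_mul_horizontal hab.le hf_bot h_bot
  have e_top := im_integral_logDeriv_mul_horizontal hab.le hf_top h_top
  have e_right := im_I_mul_integral_logDeriv_mul_right (a := a) hcd.le hf_right h_right
  have e_left := im_I_mul_integral_logDeriv_mul_left hcd.le hf_left h_left
  -- imaginary part of the right-hand side
  have hcorner : ((a : ℂ) + c * I) ∈ Icc a b ×ℂ Icc c d :=
    ⟨by simpa using hab.le, by simpa using hcd.le⟩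
  have hfin := finite_zeros_reProdIm hab.le hcd.le hf hcorner (h_bot a ⟨le_rfl, hab.le⟩)
  have e_rhs : (2 * (Real.pi : ℂ) * I * ∑ᶠ ρ ∈ {ρ : ℂ | f ρ = 0 ∧ ρ ∈ Ioo a b ×ℂ Ioo c d},
      ((meromorphicOrderAt f ρ).untop₀ : ℂ) * (ρ - a)).im =
      2 * π * ∑ᶠ ρ ∈ {ρ : ℂ | f ρ = 0 ∧ ρ ∈ Ioo a b ×ℂ Ioo c d},
        ((meromorphicOrderAt f ρ).untop₀ : ℝ) * (ρ.re - a) := by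
    rw [finsum_mem_eq_finite_toFinset_sum _ hfin, finsum_mem_eq_finite_toFinset_sum _ hfin,
      show (2 * (Real.pi : ℂ) * I) = I * (2 * Real.pi : ℝ) by push_cast; ring, mul_assoc, I_mul_im,
      re_ofReal_mul, re_sum]
    congr 1
    refine Finset.sum_congr rfl fun ρ _ ↦ ?_
    simp [mul_re]
  -- assemble
  have h := congrArg Complex.im hAP
  rw [e_rhs] at h
  simp only [sub_im, add_im] at h
  rw [e_bot, e_top, e_right, e_left] at h
  linarith

/-- **Littlewood's lemma, counting form** (the use made of (9.9.1) in Titchmarsh §9.16 and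
§10.28): under the hypotheses of `littlewood_lemma`, for every real `σ₀` (of interest for
`a < σ₀ < b`) the zeros of `f` in `R°` with `Re ρ ≥ σ₀`, counted with multiplicity, satisfy
`2π (σ₀ − a) · Σ_{Re ρ ≥ σ₀} m(ρ) ≤ ∫_c^d log‖f(a+it)‖ dt − ∫_c^d log‖f(b+it)‖ dt`
`  + (b − a) ∫_c^d Re(f'/f)(b+it) dt + ∫_a^b (x − a) Im(f'/f)(x+ic) dx − ∫_a^b (x − a) Im(f'/f)(x+id) dx`.
[cite: Titchmarsh1986, §9.9 (9.9.1) and §9.16] -/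
theorem littlewood_count_le {f : ℂ → ℂ} (hab : a < b) (hcd : c < d)
    (hf : AnalyticOnNhd ℂ f (Icc a b ×ℂ Icc c d))
    (h_bot : ∀ x ∈ Icc a b, f (x + c * I) ≠ 0) (h_top : ∀ x ∈ Icc a b, f (x + d * I) ≠ 0)
    (h_left : ∀ y ∈ Icc c d, f (a + y * I) ≠ 0) (h_right : ∀ y ∈ Icc c d, f (b + y * I) ≠ 0)
    (σ₀ : ℝ) :
    2 * π * (σ₀ - a) * ∑ᶠ ρ ∈ {ρ : ℂ | f ρ = 0 ∧ ρ ∈ Ioo a b ×ℂ Ioo c d ∧ σ₀ ≤ ρ.re},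
        ((meromorphicOrderAt f ρ).untop₀ : ℝ) ≤
      (∫ y in c..d, Real.log ‖f (a + y * I)‖) - (∫ y in c..d, Real.log ‖f (b + y * I)‖) +
        (b - a) * (∫ y in c..d, (deriv f (b + y * I) / f (b + y * I)).re) +
        (∫ x in a..b, (x - a) * (deriv f (x + c * I) / f (x + c * I)).im) -
        (∫ x in a..b, (x - a) * (deriv f (x + d * I) / f (x + d * I)).im) := by
  rw [← littlewood_lemma hab hcd hf h_bot h_top h_left h_right]
  have hcorner : ((a : ℂ) + c * I) ∈ Icc a b ×ℂ Icc c d :=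
    ⟨by simpa using hab.le, by simpa using hcd.le⟩
  have hfin := finite_zeros_reProdIm hab.le hcd.le hf hcorner (h_bot a ⟨le_rfl, hab.le⟩)
  set Z : Set ℂ := {ρ : ℂ | f ρ = 0 ∧ ρ ∈ Ioo a b ×ℂ Ioo c d} with hZ
  have hsub : {ρ : ℂ | f ρ = 0 ∧ ρ ∈ Ioo a b ×ℂ Ioo c d ∧ σ₀ ≤ ρ.re} = {ρ ∈ Z | σ₀ ≤ ρ.re} := by
    ext ρ; simp [hZ, and_assoc]
  rw [hsub]
  have hfin' : {ρ ∈ Z | σ₀ ≤ ρ.re}.Finite := hfin.subset (sep_subset _ _)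
  have hm : ∀ ρ ∈ Z, (0 : ℝ) ≤ ((meromorphicOrderAt f ρ).untop₀ : ℝ) := by
    intro ρ hρ
    have hρK : ρ ∈ Icc a b ×ℂ Icc c d := ⟨Ioo_subset_Icc_self hρ.2.1, Ioo_subset_Icc_self hρ.2.2⟩
    exact_mod_cast (WithTop.untop₀_nonneg.2 (hf ρ hρK).meromorphicOrderAt_nonneg :
      (0 : ℤ) ≤ (meromorphicOrderAt f ρ).untop₀)
  have hπ : 0 < 2 * π := by positivity
  -- `(σ₀ − a) Σ_{Re ρ ≥ σ₀} m ≤ Σ_{Re ρ ≥ σ₀} m (Re ρ − a) ≤ Σ_Z m (Re ρ − a)`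
  rw [finsum_mem_eq_finite_toFinset_sum _ hfin', finsum_mem_eq_finite_toFinset_sum _ hfin,
    mul_assoc, Finset.mul_sum]
  refine mul_le_mul_of_nonneg_left ?_ hπ.le
  calc ∑ ρ ∈ hfin'.toFinset, (σ₀ - a) * ((meromorphicOrderAt f ρ).untop₀ : ℝ)
      ≤ ∑ ρ ∈ hfin'.toFinset, ((meromorphicOrderAt f ρ).untop₀ : ℝ) * (ρ.re - a) := by
        refine Finset.sum_le_sum fun ρ hρ ↦ ?_
        rw [Set.Finite.mem_toFinset] at hρ
        rw [mul_comm]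
        exact mul_le_mul_of_nonneg_left (by linarith [hρ.2]) (hm ρ hρ.1)
    _ ≤ ∑ ρ ∈ hfin.toFinset, ((meromorphicOrderAt f ρ).untop₀ : ℝ) * (ρ.re - a) := by
        refine Finset.sum_le_sum_of_subset_of_nonneg ?_ fun ρ hρ _ ↦ ?_
        · intro ρ hρ
          rw [Set.Finite.mem_toFinset] at hρ ⊢
          exact hρ.1
        · rw [Set.Finite.mem_toFinset] at hρ
          exact mul_nonneg (hm ρ hρ) (by linarith [hρ.2.1.1])

/-! ## The horizontal terms against a Backlund-type bound -/

/-- `∫_a^b (x − a) g(x) dx = ∫_a^b (∫_σ^b g(x) dx) dσ` for `g` continuous on `[a, b]` (integration by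
parts with `u = σ − a`, `v = ∫_σ^b g`; equivalently Fubini on the triangle `a ≤ σ ≤ x ≤ b`).
[folklore] -/
theorem integral_sub_mul_eq_integral_integral {g : ℝ → ℝ} (hab : a ≤ b)
    (hg : ContinuousOn g (Icc a b)) :
    ∫ x in a..b, (x - a) * g x = ∫ σ in a..b, ∫ x in σ..b, g x := by
  -- extend `g` continuously by constants outside `[a, b]`
  set G : ℝ → ℝ := IccExtend hab (fun x : Icc a b ↦ g x) with hG
  have hGc : Continuous G := (hg.restrict).Icc_extend'
  have hGeq : ∀ x ∈ Icc a b, G x = g x := fun x hx ↦ by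
    rw [hG, IccExtend_of_mem hab _ hx]
  -- both sides only see `[a, b]`
  have hl : ∫ x in a..b, (x - a) * g x = ∫ x in a..b, (x - a) * G x := by
    refine intervalIntegral.integral_congr fun x hx ↦ ?_
    rw [uIcc_of_le hab] at hx
    simp only [hGeq x hx]
  have hr : ∫ σ in a..b, (∫ x in σ..b, g x) = ∫ σ in a..b, ∫ x in σ..b, G x := by
    refine intervalIntegral.integral_congr fun σ hσ ↦ ?_
    rw [uIcc_of_le hab] at hσ
    refine intervalIntegral.integral_congr fun x hx ↦ ?_
    rw [uIcc_of_le hσ.2] at hx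
    simp only [hGeq x ⟨hσ.1.trans hx.1, hx.2⟩]
  rw [hl, hr]
  -- integration by parts for the continuous `G`
  have hu : ∀ σ ∈ uIcc a b, HasDerivAt (fun σ : ℝ ↦ σ - a) 1 σ := fun σ _ ↦
    (hasDerivAt_id σ).sub_const a
  have hv : ∀ σ ∈ uIcc a b, HasDerivAt (fun σ : ℝ ↦ ∫ x in σ..b, G x) (-G σ) σ := by
    intro σ _
    have h := (hGc.integral_hasStrictDerivAt b σ).hasDerivAt
    have e : (fun σ : ℝ ↦ ∫ x in σ..b, G x) = fun σ ↦ -∫ x in b..σ, G x := by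
      funext σ; rw [intervalIntegral.integral_symm]
    rw [e]
    exact h.neg
  have hu' : IntervalIntegrable (fun _ : ℝ ↦ (1 : ℝ)) volume a b := intervalIntegrable_const
  have hv' : IntervalIntegrable (fun σ : ℝ ↦ -G σ) volume a b := hGc.neg.intervalIntegrable _ _
  have h := intervalIntegral.integral_mul_deriv_eq_deriv_mul hu hv hu' hv'
  simp only [intervalIntegral.integral_same, mul_zero, sub_self, zero_mul, one_mul,
    mul_neg, intervalIntegral.integral_neg, zero_sub] at h
  linarith

/-- If `|∫_σ^b g| ≤ B` for every `σ ∈ [a, b]` (`g` continuous on `[a, b]`), then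
`|∫_a^b (x − a) g(x) dx| ≤ (b − a) B`. [folklore] -/
theorem abs_integral_sub_mul_le {g : ℝ → ℝ} (hab : a ≤ b) (hg : ContinuousOn g (Icc a b)) {B : ℝ}
    (hB : ∀ σ ∈ Icc a b, |∫ x in σ..b, g x| ≤ B) :
    |∫ x in a..b, (x - a) * g x| ≤ (b - a) * B := by
  rw [integral_sub_mul_eq_integral_integral hab hg]
  have h := intervalIntegral.norm_integral_le_of_norm_le_const (a := a) (b := b)
    (f := fun σ : ℝ ↦ ∫ x in σ..b, g x) (C := B) fun σ hσ ↦ ?_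
  · rw [Real.norm_eq_abs, abs_of_nonneg (sub_nonneg.2 hab), mul_comm] at h
    exact h
  · rw [uIoc_of_le hab] at hσ
    rw [Real.norm_eq_abs]
    exact hB σ (Ioc_subset_Icc_self hσ)

/-- The horizontal terms of `littlewood_lemma` against a bound for the variation of the argument:
if `f` is analytic and non-zero on `[a, b] × {y}` and `|Im ∫_σ^b (f'/f)(x+iy) dx| ≤ B` for all
`σ ∈ [a, b]` (e.g. Backlund's bound, `Literature.Analysis.Complex.abs_im_integral_logDeriv_le_backlund`),
then `|∫_a^b (x − a) Im(f'/f)(x+iy) dx| ≤ (b − a) B`. [cite: Titchmarsh1986, §9.9 and §9.4] -/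
theorem abs_integral_sub_mul_im_logDeriv_le {f : ℂ → ℂ} {y : ℝ} (hab : a ≤ b)
    (hf : ∀ x ∈ Icc a b, AnalyticAt ℂ f (x + y * I)) (h0 : ∀ x ∈ Icc a b, f (x + y * I) ≠ 0)
    {B : ℝ} (hB : ∀ σ ∈ Icc a b, |(∫ x in σ..b, deriv f (x + y * I) / f (x + y * I)).im| ≤ B) :
    |∫ x in a..b, (x - a) * (deriv f (x + y * I) / f (x + y * I)).im| ≤ (b - a) * B := by
  have hL := continuousOn_logDeriv_horizontal hf h0
  refine abs_integral_sub_mul_le hab (continuous_im.comp_continuousOn hL) fun σ hσ ↦ ?_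
  have hint : IntervalIntegrable (fun x : ℝ ↦ deriv f (x + y * I) / f (x + y * I)) volume σ b :=
    (hL.mono (Icc_subset_Icc hσ.1 le_rfl)).intervalIntegrable_of_Icc hσ.2
  have hcomm := Complex.imCLM.intervalIntegral_comp_comm hint
  simp only [Complex.imCLM_apply] at hcomm
  rw [show (fun x : ℝ ↦ (im ∘ fun x : ℝ ↦ deriv f (x + y * I) / f (x + y * I)) x) =
      fun x : ℝ ↦ (deriv f (x + y * I) / f (x + y * I)).im from rfl, hcomm]
  exact hB σ hσ

/-! ## The arithmetic–geometric mean step -/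

/-- **`∫_c^d log h ≤ (d − c) log((d − c)⁻¹ ∫_c^d h)`** for `h` continuous and positive on `[c, d]`,
`c < d` (concavity of `log`: `log x ≤ log M + (x − M)/M` with `M` the mean of `h`; Titchmarsh §9.16).
[cite: Titchmarsh1986, §9.16] -/
theorem integral_log_le_mul_log_average {h : ℝ → ℝ} (hcd : c < d) (hc : ContinuousOn h (Icc c d))
    (hpos : ∀ y ∈ Icc c d, 0 < h y) :
    ∫ y in c..d, Real.log (h y) ≤ (d - c) * Real.log ((d - c)⁻¹ * ∫ y in c..d, h y) := by
  have hint : IntervalIntegrable h volume c d := hc.intervalIntegrable_of_Icc hcd.le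
  have hI : 0 < ∫ y in c..d, h y :=
    intervalIntegral.intervalIntegral_pos_of_pos_on hint (fun y hy ↦ hpos y (Ioo_subset_Icc_self hy)) hcd
  have hdc : 0 < d - c := sub_pos.2 hcd
  set M : ℝ := (d - c)⁻¹ * ∫ y in c..d, h y with hM
  have hM0 : 0 < M := by positivity
  have hlog : IntervalIntegrable (fun y ↦ Real.log (h y)) volume c d :=
    (hc.log fun y hy ↦ (hpos y hy).ne').intervalIntegrable_of_Icc hcd.le
  have htan : IntervalIntegrable (fun y ↦ Real.log M + (h y - M) / M) volume c d :=
    (intervalIntegrable_const).add ((hint.sub intervalIntegrable_const).div_const M)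
  have hle : ∫ y in c..d, Real.log (h y) ≤ ∫ y in c..d, (Real.log M + (h y - M) / M) := by
    refine intervalIntegral.integral_mono_on hcd.le hlog htan fun y hy ↦ ?_
    have h1 : Real.log (h y) - Real.log M = Real.log (h y / M) := (Real.log_div (hpos y hy).ne' hM0.ne').symm
    have h2 : Real.log (h y / M) ≤ h y / M - 1 := Real.log_le_sub_one_of_pos (div_pos (hpos y hy) hM0)
    have h3 : (h y - M) / M = h y / M - 1 := by field_simp
    linarith
  have hval : ∫ y in c..d, (Real.log M + (h y - M) / M) = (d - c) * Real.log M := by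
    rw [intervalIntegral.integral_add intervalIntegrable_const
      ((hint.sub intervalIntegrable_const).div_const M), intervalIntegral.integral_const,
      intervalIntegral.integral_div, intervalIntegral.integral_sub hint intervalIntegrable_const,
      intervalIntegral.integral_const, smul_eq_mul, smul_eq_mul]
    have e : ∫ y in c..d, h y = (d - c) * M := by
      rw [hM]; field_simp
    rw [e]
    field_simp
    ring
  linarith

/-- `t ↦ ‖f(x + it)‖²` is continuous along a vertical segment on which `f` is analytic.
[folklore] -/
theorem continuousOn_norm_sq_vertical {f : ℂ → ℂ} {x : ℝ}
    (hf : ∀ y ∈ Icc c d, AnalyticAt ℂ f (x + y * I)) :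
    ContinuousOn (fun y : ℝ ↦ ‖f (x + y * I)‖ ^ 2) (Icc c d) := by
  intro y hy
  have hc : Continuous fun y : ℝ ↦ (x : ℂ) + y * I := by fun_prop
  have h1 : ContinuousAt (fun y : ℝ ↦ f (x + y * I)) y :=
    (hf y hy).continuousAt.comp (f := fun y : ℝ ↦ (x : ℂ) + y * I) hc.continuousAt
  exact (h1.norm.pow 2).continuousWithinAt

/-- **Littlewood's lemma with the mean square** (the form used in Levinson's method, Titchmarsh
§10.28 between (10.28.9) and (10.28.11), and in §9.16): under the hypotheses of
`littlewood_lemma`, if `|Im ∫_σ^b (f'/f)(x+ic) dx| ≤ B_c` and `|Im ∫_σ^b (f'/f)(x+id) dx| ≤ B_d` for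
all `σ ∈ [a, b]`, then for every `σ₀`
`2π (σ₀ − a) Σ_{Re ρ ≥ σ₀} m(ρ) ≤ ½ (d − c) log((d − c)⁻¹ ∫_c^d ‖f(a+it)‖² dt) − ∫_c^d log‖f(b+it)‖ dt`
`  + (b − a) ∫_c^d Re(f'/f)(b+it) dt + (b − a)(B_c + B_d)`.
[cite: Titchmarsh1986, §9.16 and §10.28 (10.28.11)] -/
theorem littlewood_count_le_of_meanSquare {f : ℂ → ℂ} (hab : a < b) (hcd : c < d)
    (hf : AnalyticOnNhd ℂ f (Icc a b ×ℂ Icc c d))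
    (h_bot : ∀ x ∈ Icc a b, f (x + c * I) ≠ 0) (h_top : ∀ x ∈ Icc a b, f (x + d * I) ≠ 0)
    (h_left : ∀ y ∈ Icc c d, f (a + y * I) ≠ 0) (h_right : ∀ y ∈ Icc c d, f (b + y * I) ≠ 0)
    (σ₀ : ℝ) {Bc Bd : ℝ}
    (hBc : ∀ σ ∈ Icc a b, |(∫ x in σ..b, deriv f (x + c * I) / f (x + c * I)).im| ≤ Bc)
    (hBd : ∀ σ ∈ Icc a b, |(∫ x in σ..b, deriv f (x + d * I) / f (x + d * I)).im| ≤ Bd) :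
    2 * π * (σ₀ - a) * ∑ᶠ ρ ∈ {ρ : ℂ | f ρ = 0 ∧ ρ ∈ Ioo a b ×ℂ Ioo c d ∧ σ₀ ≤ ρ.re},
        ((meromorphicOrderAt f ρ).untop₀ : ℝ) ≤
      (d - c) / 2 * Real.log ((d - c)⁻¹ * ∫ y in c..d, ‖f (a + y * I)‖ ^ 2) -
        (∫ y in c..d, Real.log ‖f (b + y * I)‖) +
        (b - a) * (∫ y in c..d, (deriv f (b + y * I) / f (b + y * I)).re) +
        (b - a) * (Bc + Bd) := by
  have h := littlewood_count_le hab hcd hf h_bot h_top h_left h_right σ₀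
  have hf_bot : ∀ x ∈ Icc a b, AnalyticAt ℂ f (x + c * I) := fun x hx ↦
    hf _ ⟨by simpa using hx, by simpa using left_mem_Icc.2 hcd.le⟩
  have hf_top : ∀ x ∈ Icc a b, AnalyticAt ℂ f (x + d * I) := fun x hx ↦
    hf _ ⟨by simpa using hx, by simpa using right_mem_Icc.2 hcd.le⟩
  have hf_left : ∀ y ∈ Icc c d, AnalyticAt ℂ f (a + y * I) := fun y hy ↦
    hf _ ⟨by simpa using left_mem_Icc.2 hab.le, by simpa using hy⟩
  -- horizontal terms
  have hc' := abs_le.1 (abs_integral_sub_mul_im_logDeriv_le hab.le hf_bot h_bot hBc)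
  have hd' := abs_le.1 (abs_integral_sub_mul_im_logDeriv_le hab.le hf_top h_top hBd)
  -- the mean square on the left edge
  have hsq : ∫ y in c..d, Real.log ‖f (a + y * I)‖ =
      (1 / 2) * ∫ y in c..d, Real.log (‖f (a + y * I)‖ ^ 2) := by
    rw [← intervalIntegral.integral_const_mul]
    refine intervalIntegral.integral_congr fun y _ ↦ ?_
    rw [Real.log_pow]
    push_cast
    ring
  have hamgm := integral_log_le_mul_log_average hcd (continuousOn_norm_sq_vertical hf_left)
    fun y hy ↦ pow_pos (norm_pos_iff.2 (h_left y hy)) 2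
  rw [hsq] at h
  nlinarith [hamgm, hc'.2, hd'.1]

end Literature.NumberTheory.LFunctions

end
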